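import Mathlib
import Summits.AtomisticToContinuum.Crystallization.Theses.ChessboardParticlePlanes
import Summits.AtomisticToContinuum.Crystallization.Theorems.ChessboardParticlePlanesLjLaminarWindowsEnergyGapReduction
import Summits.AtomisticToContinuum.Crystallization.Theorems.ChargedEnergyGap.Negative.Periodisation
import HarnessLib

/-!
# `LjLaminarWindows` from a gap for everywhere-non-laminar PERIODIC configurations — line `Sketch`,
crux stmt-AtomisticToContinuum-6711 (lead c15): the periodisation step S3 ⇒ (Gap) ⇒ crux

The crux `LjLaminarWindows` of route `ChessboardParticlePlanes` is equivalent to its one-window laminarity residual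
S9♯ (`LjLaminarWindows_iff_allGroundStates`) and follows from the ground-state-free energy gap (Gap) for uniformly
non-laminar FINITE configurations (`LjLaminarWindows_of_nonLaminarEnergyGap`, rev. 19).  This file lands the
periodisation step typed by the crux strategist (STRATEGY-CENSUS.md §Strengthen S3, §Decomposition D1): the same gap
asked only of PERIODIC configurations implies (Gap), hence the crux.

* **(PerGap)** for every radius `L` and thickness `η > 0` there is `c > 0` such that every `7/10`-separated periodic
  configuration `Q` of `ℝ³` none of whose points `p` has an `η`-laminar closed `L`-window (no linear isometry `A`
  and `3/4`-separated `T ⊂ ℝ` put every point of `Q` within `L` of `p` within `η` of `T` in the rotated third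
  coordinate) satisfies `⨅_{Q'} e(Q') + c ≤ e(Q)`.

(PerGap) ⇒ (Gap) (`nonLaminarEnergyGap_of_periodicNonLaminarGap`): periodise a `7/10`-separated everywhere-non-laminar
`y : Fin M → ℝ³` with the cubic lattice of period `2Σ‖yⱼ‖ + 2` (`ChargedEnergyGapNegative.periodise`): the images are
`≥ 2` away from the motif, so the periodic point set is still `7/10`-separated; the closed `L`-window of the periodic set
at a point `yᵢ + g` CONTAINS the translate of the `L`-window of `y` at `yᵢ`, and supersets of non-laminar windows are
non-laminar, so the periodic set is everywhere non-laminar; and `e(periodisation) ≤ 𝓔(y)/M` (cross terms `≤ 0`,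
`energyPerParticle_periodise_le`).  Hence `(⨅e + c)·M ≤ 𝓔(y)` for EVERY `M` (no threshold).  (A second door of the same kind, the strategist's priced form S4 —
`N·⨅e + γ·#{non-laminar centres} ≤ 𝓔(y)` for all injective `y` — gives (Gap) with `c = γ` by counting:
`nonLaminarEnergyGap_of_laminarityPrice`, `LjLaminarWindows_of_laminarityPrice`.)  With the landed
(Gap) ⇒ crux this gives the closing recipe `LjLaminarWindows_of_periodicNonLaminarGap`: a statement about lattice sums
of periodic point sets only — the cleanest variational sufficient condition for the crux; it is open (it contains the
tetrahedral-frustration pricing of 3-D crystallization, Blanc–Lewin 2015 §2.3) and is NOT claimed here.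
-/

noncomputable section

open Filter
open Literature.MathematicalPhysics.StatisticalMechanics
open Literature.Barriers.AtomisticToContinuum (cubicLattice)
open Summit.AtomisticToContinuum.Crystallization.Theorems.ChargedEnergyGapNegative

namespace Summit.AtomisticToContinuum.Crystallization.Theorems.LjLaminarWindowsSketch

section Periodise

variable {M : ℕ} (y : Fin M → EuclideanSpace ℝ (Fin 3)) (c : ℝˣ) (hc : period y ≤ (c : ℝ)) (hM : 0 < M)

/-- Points of the periodisation `y + cℤ³` are exactly the translates `y i + g`, `g ∈ cℤ³`. [folklore] -/
theorem mem_points_periodise_iff (z : EuclideanSpace ℝ (Fin 3)) :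
    z ∈ (periodise y c hc hM).points ↔ ∃ i : Fin M, ∃ g ∈ cubicLattice c, z = y i + g := by
  constructor
  · rintro ⟨p, hp, g, hg, rfl⟩
    rw [motif_periodise] at hp
    obtain ⟨i, -, rfl⟩ := Finset.mem_image.1 hp
    exact ⟨i, g, hg, rfl⟩
  · rintro ⟨i, g, hg, rfl⟩
    refine ⟨y i, ?_, g, hg, rfl⟩
    rw [motif_periodise]
    exact Finset.mem_image_of_mem y (Finset.mem_univ i)

include hc in
/-- A translate `y j + g` of a motif point by a non-zero period is not a motif point (distinct motif points differ
by less than the shortest non-zero period). [folklore] -/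
theorem add_ne_of_mem_cubicLattice {g : EuclideanSpace ℝ (Fin 3)} (hg : g ∈ cubicLattice c) (hg0 : g ≠ 0) (j m : Fin M) :
    y j + g ≠ y m := by
  intro h
  have hcpos : 0 < (c : ℝ) := lt_of_lt_of_le (period_pos y) hc
  have h1 : (c : ℝ) ≤ ‖g‖ := le_norm_of_mem_cubicLattice hcpos hg hg0
  have h2 : ‖g‖ ≤ 2 * Dsum y := by
    have : g = y m - y j := by rw [← h]; abel
    rw [this, ← dist_eq_norm]
    exact dist_le_two_Dsum y m j
  unfold period at hc
  linarith

/-- **Separation is inherited by the periodisation**: if `y` is `7/10`-separated then so is the point set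
`y + cℤ³` (two points in the same cell are two `y`'s; points in different cells are `≥ 2` apart). [folklore] -/
theorem periodise_separated (hsep : ∀ j k : Fin M, j ≠ k → (7 : ℝ) / 10 ≤ dist (y j) (y k))
    {p q : EuclideanSpace ℝ (Fin 3)} (hp : p ∈ (periodise y c hc hM).points) (hq : q ∈ (periodise y c hc hM).points)
    (hpq : p ≠ q) : (7 : ℝ) / 10 ≤ dist p q := by
  obtain ⟨i, g, hg, rfl⟩ := (mem_points_periodise_iff y c hc hM p).1 hp
  obtain ⟨j, g', hg', rfl⟩ := (mem_points_periodise_iff y c hc hM q).1 hq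
  have hdist : dist (y i + g) (y j + g') = dist (y i) (y j + (g' - g)) := by
    simp only [dist_eq_norm]
    congr 1
    abel
  rw [hdist]
  by_cases h0 : g' - g = 0
  · have hgg : g' = g := sub_eq_zero.1 h0
    subst hgg
    rw [sub_self, add_zero]
    have hij : i ≠ j := by
      rintro rfl
      exact hpq rfl
    exact hsep i j hij
  · have hmem : y j + (g' - g) ∈ (periodise y c hc hM).points :=
      (mem_points_periodise_iff y c hc hM _).2 ⟨j, g' - g, (cubicLattice c).sub_mem hg' hg, rfl⟩
    have hfar : ∀ m : Fin M, y j + (g' - g) ≠ y m :=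
      fun m => add_ne_of_mem_cubicLattice y c hc ((cubicLattice c).sub_mem hg' hg) h0 j m
    have h2 := two_le_dist_of_mem_points y c hc hM i hmem hfar
    linarith

/-- **Laminar windows descend from the periodisation to `y`**: the closed `L`-window of `y + cℤ³` at `y i + g`
contains the `g`-translate of the closed `L`-window of `y` at `y i`, with the same relative position vectors; so an
`η`-laminar window of the periodic set at `y i + g` (isometry `A`, heights `T`) is an `η`-laminar window of `y` at
`i` for the same `A`, `T`. [folklore] -/
theorem laminarAt_of_periodise {L η : ℝ} {p : EuclideanSpace ℝ (Fin 3)} (hp : p ∈ (periodise y c hc hM).points)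
    {A : EuclideanSpace ℝ (Fin 3) →ₗᵢ[ℝ] EuclideanSpace ℝ (Fin 3)} {T : Set ℝ}
    (hT : ∀ q ∈ (periodise y c hc hM).points, dist q p ≤ L → ∃ t ∈ T, |(A (q - p)) 2 - t| ≤ η) :
    ∃ i : Fin M, ∀ j : Fin M, dist (y j) (y i) ≤ L → ∃ t ∈ T, |(A (y j - y i)) 2 - t| ≤ η := by
  obtain ⟨i, g, hg, rfl⟩ := (mem_points_periodise_iff y c hc hM p).1 hp
  refine ⟨i, fun j hj => ?_⟩
  have hmem : y j + g ∈ (periodise y c hc hM).points :=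
    (mem_points_periodise_iff y c hc hM _).2 ⟨j, g, hg, rfl⟩
  have hd : dist (y j + g) (y i + g) ≤ L := by rwa [dist_add_right]
  obtain ⟨t, ht, hclose⟩ := hT (y j + g) hmem hd
  refine ⟨t, ht, ?_⟩
  have hsub : y j + g - (y i + g) = y j - y i := by abel
  rwa [hsub] at hclose

end Periodise

/-- A `7/10`-separated configuration is injective. [folklore] -/
theorem injective_of_separated {M : ℕ} {y : Fin M → EuclideanSpace ℝ (Fin 3)}
    (hsep : ∀ j k : Fin M, j ≠ k → (7 : ℝ) / 10 ≤ dist (y j) (y k)) : Function.Injective y := by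
  intro j k hjk
  by_contra hne
  have h := hsep j k hne
  rw [hjk, dist_self] at h
  norm_num at h

/-- **D1, the periodisation step (PerGap) ⇒ (Gap)** (crux strategist census, §Decomposition): a positive gap above
the periodic infimum for everywhere-non-laminar `7/10`-separated PERIODIC configurations forces the same gap, per
particle and with no size threshold, for everywhere-non-laminar `7/10`-separated FINITE configurations:
`(⨅_Q e(Q) + c)·M ≤ 𝓔_LJ(y)`.  Periodise `y` with the cubic lattice of period `2Σ‖yⱼ‖ + 2`; separation and
everywhere-non-laminarity pass to the periodic set, and its energy per particle is `≤ 𝓔(y)/M`. [folklore] -/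
theorem nonLaminarEnergyGap_of_periodicNonLaminarGap :
    (∀ L η : ℝ, 0 < η → ∃ c : ℝ, 0 < c ∧ ∀ Q : PeriodicConfiguration 3,
      (∀ p ∈ Q.points, ∀ q ∈ Q.points, p ≠ q → (7 : ℝ) / 10 ≤ dist p q) →
      (¬ ∃ p ∈ Q.points, ∃ (A : EuclideanSpace ℝ (Fin 3) →ₗᵢ[ℝ] EuclideanSpace ℝ (Fin 3)) (T : Set ℝ),
        (∀ t ∈ T, ∀ t' ∈ T, t ≠ t' → (3 : ℝ) / 4 ≤ |t - t'|) ∧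
        (∀ q ∈ Q.points, dist q p ≤ L → ∃ t ∈ T, |(A (q - p)) 2 - t| ≤ η)) →
      (⨅ Q' : PeriodicConfiguration 3, Q'.energyPerParticle lennardJones) + c ≤
        Q.energyPerParticle lennardJones) →
    ∀ L η : ℝ, 0 < η → ∃ c : ℝ, 0 < c ∧ ∃ M₀ : ℕ, ∀ M : ℕ, M₀ ≤ M →
      ∀ y : Fin M → EuclideanSpace ℝ (Fin 3),
      (∀ j k : Fin M, j ≠ k → (7 : ℝ) / 10 ≤ dist (y j) (y k)) →
      (¬ ∃ (i : Fin M) (A : EuclideanSpace ℝ (Fin 3) →ₗᵢ[ℝ] EuclideanSpace ℝ (Fin 3)) (T : Set ℝ),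
        (∀ t ∈ T, ∀ t' ∈ T, t ≠ t' → (3 : ℝ) / 4 ≤ |t - t'|) ∧
        (∀ j : Fin M, dist (y j) (y i) ≤ L → ∃ t ∈ T, |(A (y j - y i)) 2 - t| ≤ η)) →
      ((⨅ Q : PeriodicConfiguration 3, Q.energyPerParticle lennardJones) + c) * M ≤
        interactionEnergy lennardJones y := by
  intro hPer L η hη
  obtain ⟨c, hc, hQ⟩ := hPer L η hη
  refine ⟨c, hc, 0, fun M _ y hsep hno => ?_⟩
  rcases Nat.eq_zero_or_pos M with rfl | hM
  · simp [interactionEnergy]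
  have hinj : Function.Injective y := injective_of_separated hsep
  set P := periodise y (periodUnit y) le_rfl hM with hP
  -- the periodic set is `7/10`-separated …
  have hPsep : ∀ p ∈ P.points, ∀ q ∈ P.points, p ≠ q → (7 : ℝ) / 10 ≤ dist p q :=
    fun p hp q hq hpq => periodise_separated y (periodUnit y) le_rfl hM hsep hp hq hpq
  -- … and everywhere non-laminar
  have hPno : ¬ ∃ p ∈ P.points, ∃ (A : EuclideanSpace ℝ (Fin 3) →ₗᵢ[ℝ] EuclideanSpace ℝ (Fin 3))
      (T : Set ℝ), (∀ t ∈ T, ∀ t' ∈ T, t ≠ t' → (3 : ℝ) / 4 ≤ |t - t'|) ∧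
        (∀ q ∈ P.points, dist q p ≤ L → ∃ t ∈ T, |(A (q - p)) 2 - t| ≤ η) := by
    rintro ⟨p, hp, A, T, hT, hwin⟩
    obtain ⟨i, hi⟩ := laminarAt_of_periodise y (periodUnit y) le_rfl hM hp hwin
    exact hno ⟨i, A, T, hT, hi⟩
  have h1 := hQ P hPsep hPno
  have h2 : P.energyPerParticle lennardJones ≤ interactionEnergy lennardJones y / M :=
    energyPerParticle_periodise_le hinj (periodUnit y) le_rfl hM
  have hMr : (0 : ℝ) < M := by exact_mod_cast hM
  have h3 := h1.trans h2
  rwa [le_div_iff₀ hMr] at h3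

/-- **(PerGap) ⇒ the crux `LjLaminarWindows`**: the closing recipe through the periodic variational gap
(`nonLaminarEnergyGap_of_periodicNonLaminarGap`, then the landed (Gap) ⇒ crux, `LjLaminarWindows_of_nonLaminarEnergyGap`).
[folklore] -/
theorem LjLaminarWindows_of_periodicNonLaminarGap
    (hPer : ∀ L η : ℝ, 0 < η → ∃ c : ℝ, 0 < c ∧ ∀ Q : PeriodicConfiguration 3,
      (∀ p ∈ Q.points, ∀ q ∈ Q.points, p ≠ q → (7 : ℝ) / 10 ≤ dist p q) →
      (¬ ∃ p ∈ Q.points, ∃ (A : EuclideanSpace ℝ (Fin 3) →ₗᵢ[ℝ] EuclideanSpace ℝ (Fin 3)) (T : Set ℝ),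
          (∀ t ∈ T, ∀ t' ∈ T, t ≠ t' → (3 : ℝ) / 4 ≤ |t - t'|) ∧
          (∀ q ∈ Q.points, dist q p ≤ L → ∃ t ∈ T, |(A (q - p)) 2 - t| ≤ η)) →
      (⨅ Q' : PeriodicConfiguration 3, Q'.energyPerParticle lennardJones) + c ≤
        Q.energyPerParticle lennardJones) :
    Summit.AtomisticToContinuum.Crystallization.Theses.ChessboardParticlePlanes.LjLaminarWindows :=
  LjLaminarWindows_of_nonLaminarEnergyGap (nonLaminarEnergyGap_of_periodicNonLaminarGap hPer)

/-! ## The priced form: laminarity price (S4) ⇒ (Gap) ⇒ crux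

The crux strategist's S4 (`S4_LaminarityPrice`, the radius-`L` version of stub A `stub_firstShellLayeringPrice` of line
`birth` on item 14293): for every `L`, `η > 0` some `γ > 0` with `N·⨅e + γ·#{non-(η,L)-laminar centres} ≤ 𝓔_LJ(y)` for EVERY
injective `y`.  If no centre is laminar the count is `N`, which is (Gap) with `c = γ` and no threshold. -/

/-- If every index satisfies `p`, the subtype has the cardinality of `Fin M`. [folklore] -/
theorem natCard_subtype_of_forall {M : ℕ} {p : Fin M → Prop} (h : ∀ i, p i) :
    (Nat.card {i : Fin M // p i} : ℝ) = M := by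
  rw [Nat.card_congr (Equiv.subtypeUnivEquiv h), Nat.card_eq_fintype_card, Fintype.card_fin]

/-- **S4 ⇒ (Gap)**: a laminarity price `γ` per non-laminar centre, valid for all injective configurations, gives the
energy gap `(⨅e + γ)·M ≤ 𝓔(y)` for everywhere-non-laminar `7/10`-separated configurations (all `M`). [folklore] -/
theorem nonLaminarEnergyGap_of_laminarityPrice
    (hPrice : ∀ L η : ℝ, 0 < η → ∃ γ : ℝ, 0 < γ ∧ ∀ (N : ℕ) (y : Fin N → EuclideanSpace ℝ (Fin 3)),
      Function.Injective y →
      (N : ℝ) * (⨅ Q : PeriodicConfiguration 3, Q.energyPerParticle lennardJones) +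
        γ * (Nat.card {i : Fin N // ¬ ∃ (A : EuclideanSpace ℝ (Fin 3) →ₗᵢ[ℝ] EuclideanSpace ℝ (Fin 3))
            (T : Set ℝ), (∀ t ∈ T, ∀ t' ∈ T, t ≠ t' → (3 : ℝ) / 4 ≤ |t - t'|) ∧
            (∀ j : Fin N, dist (y j) (y i) ≤ L → ∃ t ∈ T, |(A (y j - y i)) 2 - t| ≤ η)} : ℝ) ≤
        interactionEnergy lennardJones y) :
    ∀ L η : ℝ, 0 < η → ∃ c : ℝ, 0 < c ∧ ∃ M₀ : ℕ, ∀ M : ℕ, M₀ ≤ M →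
      ∀ y : Fin M → EuclideanSpace ℝ (Fin 3),
      (∀ j k : Fin M, j ≠ k → (7 : ℝ) / 10 ≤ dist (y j) (y k)) →
      (¬ ∃ (i : Fin M) (A : EuclideanSpace ℝ (Fin 3) →ₗᵢ[ℝ] EuclideanSpace ℝ (Fin 3)) (T : Set ℝ),
          (∀ t ∈ T, ∀ t' ∈ T, t ≠ t' → (3 : ℝ) / 4 ≤ |t - t'|) ∧
          (∀ j : Fin M, dist (y j) (y i) ≤ L → ∃ t ∈ T, |(A (y j - y i)) 2 - t| ≤ η)) →
      ((⨅ Q : PeriodicConfiguration 3, Q.energyPerParticle lennardJones) + c) * M ≤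
        interactionEnergy lennardJones y := by
  intro L η hη
  obtain ⟨γ, hγ, hN⟩ := hPrice L η hη
  refine ⟨γ, hγ, 0, fun M _ y hsep hno => ?_⟩
  have hall : ∀ i : Fin M, ¬ ∃ (A : EuclideanSpace ℝ (Fin 3) →ₗᵢ[ℝ] EuclideanSpace ℝ (Fin 3)) (T : Set ℝ),
      (∀ t ∈ T, ∀ t' ∈ T, t ≠ t' → (3 : ℝ) / 4 ≤ |t - t'|) ∧
      (∀ j : Fin M, dist (y j) (y i) ≤ L → ∃ t ∈ T, |(A (y j - y i)) 2 - t| ≤ η) :=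
    fun i hi => hno ⟨i, hi⟩
  have h := hN M y (injective_of_separated hsep)
  rw [natCard_subtype_of_forall hall] at h
  linarith

/-- **S4 ⇒ the crux `LjLaminarWindows`**: the closing recipe through a laminarity price (then (Gap) ⇒ crux). [folklore] -/
theorem LjLaminarWindows_of_laminarityPrice
    (hPrice : ∀ L η : ℝ, 0 < η → ∃ γ : ℝ, 0 < γ ∧ ∀ (N : ℕ) (y : Fin N → EuclideanSpace ℝ (Fin 3)),
      Function.Injective y →
      (N : ℝ) * (⨅ Q : PeriodicConfiguration 3, Q.energyPerParticle lennardJones) +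
        γ * (Nat.card {i : Fin N // ¬ ∃ (A : EuclideanSpace ℝ (Fin 3) →ₗᵢ[ℝ] EuclideanSpace ℝ (Fin 3))
            (T : Set ℝ), (∀ t ∈ T, ∀ t' ∈ T, t ≠ t' → (3 : ℝ) / 4 ≤ |t - t'|) ∧
            (∀ j : Fin N, dist (y j) (y i) ≤ L → ∃ t ∈ T, |(A (y j - y i)) 2 - t| ≤ η)} : ℝ) ≤
        interactionEnergy lennardJones y) :
    Summit.AtomisticToContinuum.Crystallization.Theses.ChessboardParticlePlanes.LjLaminarWindows :=
  LjLaminarWindows_of_nonLaminarEnergyGap (nonLaminarEnergyGap_of_laminarityPrice hPrice)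

end Summit.AtomisticToContinuum.Crystallization.Theorems.LjLaminarWindowsSketch

end
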